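/-
Copyright (c) 2026 the pub-hodgecm-mathlib formalisation cell (harness21).  Prover seat hodgecm-mathlib-LH4-p09 (g2), req620 Track A «(D-RAM) FOUR-FRAME» squad
(unit U3_Laws, MS ROAD A brick (O1) «ORBIT OF A NORMALISED LATTICE»; MS first seat LH4-p11 (g0) `MS-ROAD-A-BRICKS.v2` step (3) = (3c-iii); released to this seat by LH4-p12 (g0) 23:15:32Z).  2026-09-03.
-/
import Summits.HodgeConjecture.HodgeConjecture.Theorems.F0P3cDyRamDiagonalTorusDefs            -- DEFS LEAF (LH4-p11): `diagGLUnits`, `unitTorus`, `latticeStabilizer`, `unitStabilizer`, `IsNormalisedLattice`, `normalisedStableLattices`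
import Summits.HodgeConjecture.HodgeConjecture.Theorems.F0P3cDyRamDiagonalNormalisedOrbit        -- ★ J′ p855450 (LH4-p08 (g2)): `forall_normalisedAt_mapGL_diagonal_latt_iff`
import Summits.HodgeConjecture.HodgeConjecture.Theorems.F0P3cDyRamDiagonalCongruenceStabiliser   -- ★ L∕K(a) p855451 (LH4-p12): `mapGL_diagonal_mapGL_diagonal_eq_iff`
import HarnessLib

/-!
# Crux `H413`, line LH4 «(D-RAM) FOUR-FRAME» road — unit U3_Laws, MS ROAD A brick (O1): THE ORBIT OF A NORMALISED LATTICE UNDER THE DIAGONAL TORUS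
# `#(𝒯·M₀ ∩ 𝓛₀) = [𝒯 : S̃(M₀)]` — orbit–stabiliser for the unit torus `𝒯 = (𝒪^×)^N` acting on lattices by `diag`

Cell `hodgecm-mathlib` (D-0151), FLOOR 0, crux item H413 = `stmt-HodgeConjecture-24833`, route of record `HCCMUnconditional`; squad F0∕P3c∕LH4 (req618∕req620); registered stub served:
`F0P3cDyRamFourFrameU3.stub_U3_stableModelSum` (MS).  THEOREMS ONLY (no `def`, no instance, no notation, no `sorry`); lane `--supports stmt-HodgeConjecture-24833 --as helper`.

WHAT IS PROVED (LH4-p10 MEMO-stableLaw-finite v1 §2 (3), LH4-p11 BRICKS v2 (O) = (O1) + (O2)).  In the currency of the MS defs leaf `F0P3cDyRamDiagonalTorusDefs` (`diagGLUnits z = diag z`,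
`unitTorus K N = 𝒯 = {z : |z_i| = 1}`, `latticeStabilizer M = {z : diag z · M = M}`, `unitStabilizer M = S̃(M) = latticeStabilizer M ⊓ 𝒯`, `IsNormalisedLattice`, `normalisedStableLattices T = 𝓛₀(T)`):
* §1 `ncard_unitTorus_orbit_eq_relIndex` — for EVERY `𝒪`-submodule `M₀ ≤ K^N`: `#{diag u · M₀ : u ∈ 𝒯} = [𝒯 : latticeStabilizer M₀ ⊓ 𝒯]` (`Subgroup.relIndex`; both sides `0` iff
  infinite).  Pure orbit–stabiliser (Mathlib `MulAction.index_stabilizer`) for the action `u • M := mapGL (diag u) M`, assembled INSIDE the proof (no instance is declared);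
  `ncard_unitTorus_orbit_eq_relIndex_unitStabilizer` is the `S̃(M₀)`-spelling (`Subgroup.inf_relIndex_right`).
* §2 `setOf_normalised_translate_eq` — for a NORMALISED `M₀ = latt g`, the normalised diagonal translates `{diag z · M₀ : z ∈ (K^×)^N, normalised}` ARE the `𝒯`-orbit: ★ J′ p855450
  `forall_normalisedAt_mapGL_diagonal_latt_iff` (`diag z · latt g` normalised `⟺ ∀ i, |z_i| = 1`).  In particular the binder `z ∈ 𝒯·ϖ^ℤ` of the memo and `z ∈ (K^×)^N` give the same set.
* §3 HEAD `ncard_orbit_normalised_eq_relIndex` (`N = 3`, `T` diagonal): for `M₀ ∈ 𝓛₀(T)`, `#{M ∈ 𝓛₀(T) : M = diag z · M₀ for some z ∈ (K^×)³} = [𝒯 : S̃(M₀)]` — `T`-stability rides along the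
  orbit by ★ K(a) p855451 `mapGL_diagonal_mapGL_diagonal_eq_iff` (diagonal matrices commute), `latt`-ness by ★ `mapGL_latt`.  This is the (O1) input of the orbit count (O2)
  `Σ_s C₀(s) = 8 · Σ_{M₀ ∈ 𝓛₀ dualisable} 1∕[𝒰 : S_F(M₀)]`; finiteness of `[𝒯 : S̃(M₀)]` (★ L: `S̃ ⊇` a principal congruence subgroup, `Fintype 𝓀`) is NOT needed here and not claimed.
[Kottwitz1986BaseChangeUnits §1 pp. 240–241: orbital integrals of units as lattice counts modulo the torus; Serre1980Trees II §1.1.]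
HONEST LABEL.  Count-neutral (`--supports`); nothing printed is asserted; (MS) stays a PROVER TARGET (empirical census law); `HC_CM` is proved only modulo the 7 printed citations
(2 remaining named inputs: hLiu418 = `stmt-HodgeConjecture-24832`, h413 = `stmt-HodgeConjecture-24833`) until rung 0 closes.

## References
* [Kottwitz1986BaseChangeUnits] R. E. Kottwitz, *Base change for unit elements of Hecke algebras*, Compositio Math. 60 (1986), §1 pp. 240–241.
* [Serre1980Trees] J.-P. Serre, *Trees*, Springer (1980), Ch. II §1.1 (lattices and the diagonal action).
* [Rogawski1990] J. D. Rogawski, *Automorphic Representations of Unitary Groups in Three Variables*, Ann. of Math. Stud. 123 (1990), §4.9 Prop. 4.9.1 (a) p. 55.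
-/

set_option autoImplicit false

noncomputable section

namespace Summit.HodgeConjecture.HodgeConjecture.Cruxes.H413.F0P3cDyRamDiagonalUnitTorusOrbit

open Matrix
open Literature.NumberTheory.Automorphic Literature.NumberTheory.Automorphic.HermitianLattice
open Literature.NumberTheory.Automorphic.UnitaryLatticeTree
open Summit.HodgeConjecture.HodgeConjecture.Cruxes.H413.F0P3cDyRamDiagonalTorusDefs
open Summit.HodgeConjecture.HodgeConjecture.Cruxes.H413.F0P3cDyRamDiagonalNormalisedOrbit
open Summit.HodgeConjecture.HodgeConjecture.Cruxes.H413.F0P3cDyRamDiagonalCongruenceStabiliser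
open scoped Valued WithZero Matrix MatrixGroups

variable {K : Type*} [Field K] [Valued K ℤᵐ⁰] {N : ℕ}

/-! ## §1  Orbit–stabiliser for the unit torus acting by `diag` -/

/-- **`#(𝒯 · M₀) = [𝒯 : latticeStabilizer M₀ ⊓ 𝒯]`** for every `𝒪`-submodule `M₀ ≤ K^N`: the number of distinct translates `diag u · M₀`, `u ∈ 𝒯 = unitTorus`, is the relative index of
the diagonal stabiliser in the unit torus (Mathlib `Set.ncard`∕`Subgroup.relIndex`: both are `0` exactly when the orbit is infinite).  Orbit–stabiliser for the action
`u • M := mapGL (diagGLUnits u) M`, assembled locally from ★ `mapGL_one`∕`mapGL_mul`. [cite: Kottwitz1986BaseChangeUnits, §1 pp. 240–241] [cite: Serre1980Trees, II §1.1] -/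
theorem ncard_unitTorus_orbit_eq_relIndex (M₀ : Submodule 𝒪[K] (Fin N → K)) :
    {M : Submodule 𝒪[K] (Fin N → K) | ∃ u ∈ unitTorus K N, M = mapGL (diagGLUnits u) M₀}.ncard = (latticeStabilizer M₀).relIndex (unitTorus K N) := by
  classical
  letI : MulAction (Fin N → Kˣ) (Submodule 𝒪[K] (Fin N → K)) :=
    { smul := fun z M => mapGL (diagGLUnits z) M
      one_smul := fun M => by
        change mapGL (diagGLUnits (1 : Fin N → Kˣ)) M = M
        rw [map_one, mapGL_one]
      mul_smul := fun z w M => by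
        change mapGL (diagGLUnits (z * w)) M = mapGL (diagGLUnits z) (mapGL (diagGLUnits w) M)
        rw [map_mul, mapGL_mul] }
  have horbit : MulAction.orbit (unitTorus K N) M₀ = {M : Submodule 𝒪[K] (Fin N → K) | ∃ u ∈ unitTorus K N, M = mapGL (diagGLUnits u) M₀} := by
    ext M
    simp only [MulAction.mem_orbit_iff, Set.mem_setOf_eq]
    constructor
    · rintro ⟨⟨u, hu⟩, rfl⟩
      exact ⟨u, hu, rfl⟩
    · rintro ⟨u, hu, rfl⟩
      exact ⟨⟨u, hu⟩, rfl⟩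
  have hstab : MulAction.stabilizer (unitTorus K N) M₀ = (latticeStabilizer M₀).subgroupOf (unitTorus K N) := by
    ext u
    rw [MulAction.mem_stabilizer_iff, Subgroup.mem_subgroupOf, mem_latticeStabilizer_iff]
    rfl
  rw [Subgroup.relIndex, ← hstab, MulAction.index_stabilizer, horbit]

/-- The `S̃(M₀)`-spelling: `#(𝒯 · M₀) = [𝒯 : unitStabilizer M₀]` (`unitStabilizer M₀ = latticeStabilizer M₀ ⊓ 𝒯`, `Subgroup.inf_relIndex_right`). [cite: Kottwitz1986BaseChangeUnits, §1 pp. 240–241] -/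
theorem ncard_unitTorus_orbit_eq_relIndex_unitStabilizer (M₀ : Submodule 𝒪[K] (Fin N → K)) :
    {M : Submodule 𝒪[K] (Fin N → K) | ∃ u ∈ unitTorus K N, M = mapGL (diagGLUnits u) M₀}.ncard = (unitStabilizer M₀).relIndex (unitTorus K N) := by
  rw [ncard_unitTorus_orbit_eq_relIndex]
  exact (Subgroup.inf_relIndex_right (latticeStabilizer M₀) (unitTorus K N)).symm

/-! ## §2  Normalised diagonal translates of a normalised lattice are exactly its unit-torus orbit -/

/-- **NORMALISED TRANSLATES = THE `𝒯`-ORBIT**: for a normalised `M₀ = latt g`, `{diag z · M₀ : z ∈ (K^×)^N, diag z · M₀ normalised} = {diag u · M₀ : u ∈ 𝒯}` — ★ J′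
`forall_normalisedAt_mapGL_diagonal_latt_iff` (`diag z · latt g` is normalised iff every `|z_i| = 1`). [cite: Serre1980Trees, II §1.1] [cite: Kottwitz1986BaseChangeUnits, §1 pp. 240–241] -/
theorem setOf_normalised_translate_eq (g : GL (Fin N) K) (hg : IsNormalisedLattice (latt (g : Matrix (Fin N) (Fin N) K))) :
    {M : Submodule 𝒪[K] (Fin N → K) | IsNormalisedLattice M ∧ ∃ z : Fin N → Kˣ, M = mapGL (diagGLUnits z) (latt (g : Matrix (Fin N) (Fin N) K))} =
      {M : Submodule 𝒪[K] (Fin N → K) | ∃ u ∈ unitTorus K N, M = mapGL (diagGLUnits u) (latt (g : Matrix (Fin N) (Fin N) K))} := by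
  ext M
  simp only [Set.mem_setOf_eq]
  constructor
  · rintro ⟨hM, z, rfl⟩
    refine ⟨z, ?_, rfl⟩
    rw [mem_unitTorus_iff]
    exact (forall_normalisedAt_mapGL_diagonal_latt_iff g (fun i => (z i : K)) (diagGLUnits z) (coe_diagGLUnits z) hg).1 hM
  · rintro ⟨u, hu, rfl⟩
    exact ⟨(forall_normalisedAt_mapGL_diagonal_latt_iff g (fun i => (u i : K)) (diagGLUnits u) (coe_diagGLUnits u) hg).2
      ((mem_unitTorus_iff u).1 hu), u, rfl⟩

/-! ## §3  The head in `𝓛₀`-currency (`N = 3`, `T` diagonal) -/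

/-- **(O1) THE ORBIT OF A NORMALISED `T`-STABLE LATTICE: `#{M ∈ 𝓛₀(T) : M ∈ (K^×)³·M₀} = [𝒯 : S̃(M₀)]`.**  For a diagonal `T` and `M₀ ∈ normalisedStableLattices T` (= `𝓛₀(T)`: `M₀ = latt g`,
`T·M₀ = M₀`, normalised), the members of `𝓛₀(T)` of the form `diag z · M₀` (`z ∈ (K^×)³`; normalisation forces `|z_i| = 1`, so the same set as with `z ∈ 𝒯·ϖ^ℤ` or `z ∈ 𝒯`) are
counted by the relative index of the unit diagonal stabiliser `S̃(M₀) = unitStabilizer M₀` in the unit torus `𝒯 = unitTorus K 3`: `T`-stability rides along the orbit because diagonal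
matrices commute (★ K(a) `mapGL_diagonal_mapGL_diagonal_eq_iff`), `latt`-ness by ★ `mapGL_latt`, normalisation by §2, the count by §1.  The (O1) input of the orbit count (O2) of
MS ROAD A step (3). [cite: Kottwitz1986BaseChangeUnits, §1 pp. 240–241] [cite: Rogawski1990, §4.9 Prop. 4.9.1 (a) p. 55] [cite: Serre1980Trees, II §1.1] -/
theorem ncard_orbit_normalised_eq_relIndex {K : Type*} [Field K] [Valued K ℤᵐ⁰] {s : Fin 3 → K} (T : GL (Fin 3) K)
    (hT : (T : Matrix (Fin 3) (Fin 3) K) = Matrix.diagonal s) {M₀ : Submodule 𝒪[K] (Fin 3 → K)} (hM₀ : M₀ ∈ normalisedStableLattices T) :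
    {M : Submodule 𝒪[K] (Fin 3 → K) | M ∈ normalisedStableLattices T ∧ ∃ z : Fin 3 → Kˣ, M = mapGL (diagGLUnits z) M₀}.ncard =
      (unitStabilizer M₀).relIndex (unitTorus K 3) := by
  obtain ⟨⟨g, rfl⟩, hTM₀, hnorm⟩ := hM₀
  have hset : {M : Submodule 𝒪[K] (Fin 3 → K) | M ∈ normalisedStableLattices T ∧ ∃ z : Fin 3 → Kˣ, M = mapGL (diagGLUnits z) (latt (g : Matrix (Fin 3) (Fin 3) K))} =
      {M : Submodule 𝒪[K] (Fin 3 → K) | IsNormalisedLattice M ∧ ∃ z : Fin 3 → Kˣ, M = mapGL (diagGLUnits z) (latt (g : Matrix (Fin 3) (Fin 3) K))} := by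
    ext M
    simp only [Set.mem_setOf_eq, mem_normalisedStableLattices_iff]
    constructor
    · rintro ⟨⟨-, -, hM⟩, z, hz⟩
      exact ⟨hM, z, hz⟩
    · rintro ⟨hM, z, rfl⟩
      refine ⟨⟨⟨diagGLUnits z * g, by rw [mapGL_latt]⟩, ?_, hM⟩, z, rfl⟩
      exact (mapGL_diagonal_mapGL_diagonal_eq_iff (diagGLUnits z) T (coe_diagGLUnits z) hT _).2 hTM₀
  rw [hset, setOf_normalised_translate_eq g hnorm, ncard_unitTorus_orbit_eq_relIndex_unitStabilizer]

end Summit.HodgeConjecture.HodgeConjecture.Cruxes.H413.F0P3cDyRamDiagonalUnitTorusOrbit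

end
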